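import Summits.QuantumFields.YangMills.Theorems.UnitScaleTiltProp7CombLoopSquareCount
import HarnessLib

/-!
# Route `UnitScaleTilt`, crux K1 «MinimiserStabilityRegPr» (stmt-QuantumFields-19200), route-R E′ path (α′), S3 K-form engine, row (H) ∕ (R4′) — FILE 9h″ «EXACT-MULT»:
# THE COUNT OF ✓ `Prop7CombLadderCount` AS AN IDENTITY WITH EXPLICIT MULTIPLICITIES — every rung of every comb of the box is met by an EXPLICIT set of combs
# (a product fibre on the TRUNK of its run), so `Σ_(v ∈ box) c(v)·Σ_(k<|B(v)|) f(rung_k) = Σ_i Σ_(q ∈ box) (W⁺_i(q)·f(q,(t_i,+)) + W⁻_i(q)·f(q,(t_i,−)))` with the weights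
# `W^±_i(q)` finitely supported filtered box sums — no `(2R+1)^(d−|D|)` sup, no `|t|·R` sup; the Cauchy–Schwarz factor `|B(v)|` rides inside as the per-comb weight `c(v)`

Cell `ym3-torus`, width seat `ym3-torus-px9` (gen 4; WIDTH COPY «width 9» of ym3-torus-p1); row named by ★ym-ust-19200-p1 g16 NAMER WORD 2 (c) (2026-08-28 23:16Z
«px9 ∕ routeR-w1: F-H9h″ EXACT-MULT … `w` an explicit FUNCTION of `q` (pure rearrangement, no sup)»).  THEOREMS ONLY (0 `def`, 0 `sorry`); `--supports stmt-QuantumFields-19200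
--as helper`, count-neutral.  YM₃ on T³ is a RUNG of the ladder (R3) — not d = 4, not infinite volume, not a mass gap, not the Clay problem; nothing here claims a stub, the
crux or any summit statement.

THE POINT (namer's ℓ-power audit, WORD 2 (b)).  ✓ `Prop7CombLadderCount.sum_box_sum_rungs_le` bounds the number of combs of the box `[−R,R]^d` through a given rung of the
run of direction `t[i]` by `(2R+1)^(d−(|D|+i))` AT EVERY position `q` of the box.  The true set of combs through the rung `(q, (κ,+))`, `κ = t[i]`, is EXPLICIT: the combs `v`
with `v|_(D_i) = q|_(D_i)` and `v κ > q κ`, and it is NON-EMPTY ONLY ON THE TRUNK `{q ν = 0 for ν ∉ D_i ∪ {κ}} ∩ {0 ≤ q κ}` of the run (`D_i = D ∪ t[0..i)`): a product fibre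
of cardinality `(R − q κ)·(2R+1)^(d−|D_i|−1)` (closed forms: part 2).  Keeping the set instead of its sup turns THE COUNT into an IDENTITY (pure `Finset.sum_comm`, any signs of `f` and of the
per-comb weight `c`), with total mass `Σ_q (W⁺+W⁻)(q) = Σ_v c(v)·|v κ|` per run; at `d = 3` the first run of a two-run tail lives on a PLANE with weight `≲ R·(2R+1)`,
the second on the box with weight `≲ R` — versus `(2R+1)²` resp. `(2R+1)` everywhere: the one power of `R ≈ ℓ` of the audit, now in the kernel's letters.

WHAT IS PROVED (ns `…Theorems.Prop7CombLadderCountExact`; letters of ✓ `Prop7CombLadderCount` verbatim: `Site d = Fin d → ℤ`, box `Fintype.piFinset (fun _ => Icc (−R) R)`,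
determined set `D`, base `Σ_(ν∈D) v ν • e ν`, run `seg κ (v κ)`, tail `B(v) = t.flatMap (κ ↦ seg κ (v κ))`; `D_i := (t.take i).foldl (fun S ν => insert ν S) D`
(= `D ∪ (t.take i).toFinset`, ✓ `mem_foldl_insert`), `κ_i := t.getD i κ₀`; the FIBRE PREDICATES, written inline,
`P⁺_(D,κ)(v,q) := (∀ ν ∈ D, q ν = v ν) ∧ (∀ ν, ν ∉ D → ν ≠ κ → q ν = 0) ∧ 0 ≤ q κ ∧ q κ < v κ`, `P⁻_(D,κ)(v,q) := … ∧ v κ < q κ ∧ q κ ≤ 0`,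
and the WEIGHTS `W^±_(D,κ)(q) := Σ_(v ∈ box, P^±(v,q)) c v`).
* §1 ONE RUN, EXACT: `getD_seg_of_nonneg ∕ _of_neg`, `rung_apply`, ★ `sum_run_eq` (the rung sum of one run = the `f(·,(κ,+))`-sum over the `q` with `P⁺(v,q)` plus the
  `f(·,(κ,−))`-sum over `P⁻(v,q)`), ★★ `sum_box_mul_sum_run_eq` (`Σ_(v∈box) c v·Σ_j … = Σ_(q∈box) (W⁺(q)·f(q,(κ,+)) + W⁻(q)·f(q,(κ,−)))`).
* §2 ALL RUNS, EXACT: ★★★ `sum_box_mul_sum_rungs_eq` (induction over `t`, `D ↦ insert κ D`), `mem_foldl_insert`.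
* §3 THE COMB COROLLARY ★★ `sum_box_mul_sum_combRungs_eq` (split `(finRange d).reverse = s ++ μ :: t`, base `insert μ s.toFinset` via ✓ `disp_base_eq_sum`) and the CONSUMER
  FORM ★★★ `sum_box_comm_loop_sq_le_exact` — ✓p675053 `sum_box_comm_loop_sq_le` with EXACT multiplicities: `Σ_(v∈box) N_m(loop_v)² ≤ Σ_i Σ_(q∈box) (W⁺_i(q)·f(q,(t_i,+)) +
  W⁻_i(q)·f(q,(t_i,−)))`, `c(v) := |B(v)|` inside `W`, the only `≤` left being the ladder bound ✓ `comm_loop_le_canonical_rungs` and Cauchy–Schwarz.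
The weights' SUPPORT (trunk), PRODUCT structure, CLOSED FORM `(R ∓ q κ)·(2R+1)^(d−(|D|+1))`, BOUNDS and MASS are part 2 (`…Prop7CombLadderCountExactWeights`, same seat).
HONEST SCOPE.  Finite combinatorics on `ℤ^d` words; no holonomy estimates, no smallness; the offset (`h`) spreading of the trunk planes and the booking against `K_gauge` are the
consumer's (routeR-w1 `_pt` chain ∕ the namer's R5 rows).

References: T. Bałaban, CMP 98 (1985) 17–51 [Balaban1985Averaging] ((8)–(9) pp.18–19, (19)–(20) p.21, p.24); CMP 95 (1984) 17–40 [Balaban1984PropagatorsI] ((1.7) p.18);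
CMP 102 (1985) 255–275 [Balaban1985UV3] ((27) p.263).
-/

set_option autoImplicit false

open scoped BigOperators

namespace Summit.QuantumFields.YangMills.Theorems.Prop7CombLadderCountExact

open Literature.MathematicalPhysics.QuantumFieldTheory.Balaban1983to89
open B7Prop1Explicit (Site Letter e e_apply disp seg treeWord hol disp_append disp_seg length_seg seg_natCast seg_negSucc)
open B10Eq27AxialLog (contour27)
open B9Eq39Adjoint (R)
open Summit.QuantumFields.YangMills.Theorems.Prop7CombLadderCount (mem_box_iff sum_zsmul_e_apply disp_take_seg sum_range_rungs_append length_flatMap_seg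
  split_nodup disp_base_eq_sum disp_base_nonneg disp_base_neg)
open Summit.QuantumFields.YangMills.Theorems.Prop7CombLoopSquareCount (comm_loop_sq_le)

variable {d : ℕ}

/-! ## §1 One run, exact -/

/-- the letters of a forward run: `(seg κ n).getD j dflt = (κ, true)` for `0 ≤ n`, `j < |n|`. [cite: Balaban1985Averaging, p.24] -/
theorem getD_seg_of_nonneg (κ : Fin d) {n : ℤ} (hn : 0 ≤ n) (j : ℕ) (hj : j < n.natAbs) (dflt : Letter d) :
    (seg κ n).getD j dflt = (κ, true) := by
  obtain ⟨m, rfl⟩ := Int.eq_ofNat_of_zero_le hn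
  rw [seg_natCast, List.getD_eq_getElem?_getD, List.getElem?_replicate, if_pos (by simpa using hj), Option.getD_some]

/-- the letters of a backward run: `(seg κ n).getD j dflt = (κ, false)` for `n < 0`, `j < |n|`. [cite: Balaban1985Averaging, p.24] -/
theorem getD_seg_of_neg (κ : Fin d) {n : ℤ} (hn : n < 0) (j : ℕ) (hj : j < n.natAbs) (dflt : Letter d) :
    (seg κ n).getD j dflt = (κ, false) := by
  obtain ⟨m, rfl⟩ := Int.eq_negSucc_of_lt_zero hn
  rw [seg_negSucc, List.getD_eq_getElem?_getD, List.getElem?_replicate, if_pos (by simpa using hj), Option.getD_some]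

/-- coordinates of a point of the run of direction `κ ∉ D` based at `Σ_(ν∈D) v ν • e ν`: `v` on `D`, the run parameter at `κ`, `0` elsewhere. [folklore] -/
theorem rung_apply (D : Finset (Fin d)) (κ : Fin d) (hκ : κ ∉ D) (v : Site d) (a : ℤ) (ν : Fin d) :
    ((∑ ν ∈ D, v ν • e ν) + a • e κ) ν = if ν ∈ D then v ν else if ν = κ then a else 0 := by
  rw [Pi.add_apply, sum_zsmul_e_apply, Pi.smul_apply, e_apply, smul_eq_mul]
  by_cases hνD : ν ∈ D
  · have hνκ : ν ≠ κ := fun h => hκ (h ▸ hνD)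
    simp [hνD, hνκ]
  · by_cases hνκ : ν = κ
    · subst hνκ; simp [hκ]
    · simp [hνD, hνκ]

/-- ★ **ONE RUN, EXACT.**  For `κ ∉ D` and a comb `v` of the box, the rung sum of the run of direction `κ` based at `Σ_(ν∈D) v ν • e ν` EQUALS the sum of `f(q,(κ,+))` over the
`q ∈ box` with `P⁺(v,q)` (agreement on `D`, trunk `q ν = 0` off `D ∪ {κ}`, `0 ≤ q κ < v κ`) plus the sum of `f(q,(κ,−))` over `P⁻(v,q)` (`v κ < q κ ≤ 0`); one of the two is
empty. [cite: Balaban1985Averaging, (8)–(9) pp.18–19, p.24] -/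
theorem sum_run_eq {M : Type*} [AddCommMonoid M] (R : ℕ) (D : Finset (Fin d)) (κ : Fin d) (hκ : κ ∉ D) (dflt : Letter d) (f : Site d → Letter d → M)
    (v : Site d) (hv : v ∈ Fintype.piFinset (fun _ : Fin d => Finset.Icc (-(R : ℤ)) (R : ℤ))) :
    ∑ j ∈ Finset.range (seg κ (v κ)).length, f ((∑ ν ∈ D, v ν • e ν) + disp ((seg κ (v κ)).take j)) ((seg κ (v κ)).getD j dflt)
      = ∑ q ∈ (Fintype.piFinset (fun _ : Fin d => Finset.Icc (-(R : ℤ)) (R : ℤ))).filter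
            (fun q => (∀ ν ∈ D, q ν = v ν) ∧ (∀ ν, ν ∉ D → ν ≠ κ → q ν = 0) ∧ 0 ≤ q κ ∧ q κ < v κ), f q (κ, true)
        + ∑ q ∈ (Fintype.piFinset (fun _ : Fin d => Finset.Icc (-(R : ℤ)) (R : ℤ))).filter
            (fun q => (∀ ν ∈ D, q ν = v ν) ∧ (∀ ν, ν ∉ D → ν ≠ κ → q ν = 0) ∧ v κ < q κ ∧ q κ ≤ 0), f q (κ, false) := by
  classical
  set box := Fintype.piFinset (fun _ : Fin d => Finset.Icc (-(R : ℤ)) (R : ℤ)) with hbox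
  have hvb := (mem_box_iff (R := R)).mp hv
  rw [length_seg]
  -- the points of the run: positions, coordinates, membership in the box, reconstruction from the `κ`-coordinate
  have hpos : ∀ j ∈ Finset.range (v κ).natAbs,
      (∑ ν ∈ D, v ν • e ν) + disp ((seg κ (v κ)).take j) = (∑ ν ∈ D, v ν • e ν) + ((v κ).sign * (j : ℤ)) • e κ :=
    fun j hj => by rw [disp_take_seg κ (v κ) j (Finset.mem_range.mp hj).le]
  have hκc : ∀ a : ℤ, ((∑ ν ∈ D, v ν • e ν) + a • e κ) κ = a := fun a => by rw [rung_apply D κ hκ, if_neg hκ, if_pos rfl]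
  have hP : ∀ a : ℤ, -(R : ℤ) ≤ a → a ≤ R → ((∑ ν ∈ D, v ν • e ν) + a • e κ ∈ box
      ∧ (∀ ν ∈ D, ((∑ ν ∈ D, v ν • e ν) + a • e κ) ν = v ν) ∧ (∀ ν, ν ∉ D → ν ≠ κ → ((∑ ν ∈ D, v ν • e ν) + a • e κ) ν = 0)) := by
    intro a ha1 ha2
    refine ⟨(mem_box_iff (R := R)).mpr fun ν => ?_, fun ν hν => by rw [rung_apply D κ hκ, if_pos hν],
      fun ν hνD hνκ => by rw [rung_apply D κ hκ, if_neg hνD, if_neg hνκ]⟩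
    rw [rung_apply D κ hκ]
    by_cases hνD : ν ∈ D
    · rw [if_pos hνD]; exact hvb ν
    · rw [if_neg hνD]
      by_cases hνκ : ν = κ
      · rw [if_pos hνκ]; exact ⟨ha1, ha2⟩
      · rw [if_neg hνκ]; constructor <;> omega
  have hrec : ∀ q : Site d, (∀ ν ∈ D, q ν = v ν) → (∀ ν, ν ∉ D → ν ≠ κ → q ν = 0) → (∑ ν ∈ D, v ν • e ν) + (q κ) • e κ = q := by
    intro q hagree htrunk
    funext ν
    rw [rung_apply D κ hκ]
    by_cases hνD : ν ∈ D
    · rw [if_pos hνD]; exact (hagree ν hνD).symm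
    · rw [if_neg hνD]
      by_cases hνκ : ν = κ
      · rw [if_pos hνκ, hνκ]
      · rw [if_neg hνκ]; exact (htrunk ν hνD hνκ).symm
  rcases lt_trichotomy (v κ) 0 with hneg | hzero | hpos'
  · -- backward run: letters `(κ,false)`, positions `q κ = -j`
    have hE : box.filter (fun q => (∀ ν ∈ D, q ν = v ν) ∧ (∀ ν, ν ∉ D → ν ≠ κ → q ν = 0) ∧ 0 ≤ q κ ∧ q κ < v κ) = ∅ :=
      Finset.filter_eq_empty_iff.mpr fun q _ h => by have := h.2.2; omega
    rw [hE, Finset.sum_empty, zero_add]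
    calc ∑ j ∈ Finset.range (v κ).natAbs, f ((∑ ν ∈ D, v ν • e ν) + disp ((seg κ (v κ)).take j)) ((seg κ (v κ)).getD j dflt)
        = ∑ j ∈ Finset.range (v κ).natAbs, f ((∑ ν ∈ D, v ν • e ν) + (-(j : ℤ)) • e κ) (κ, false) :=
          Finset.sum_congr rfl fun j hj => by
            rw [hpos j hj, Int.sign_eq_neg_one_of_neg hneg, getD_seg_of_neg κ hneg j (Finset.mem_range.mp hj) dflt, neg_one_mul]
      _ = _ := by
          refine Finset.sum_nbij' (fun j : ℕ => (∑ ν ∈ D, v ν • e ν) + (-(j : ℤ)) • e κ) (fun q => (-(q κ)).toNat) ?_ ?_ ?_ ?_ (fun _ _ => rfl)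
          · intro j hj
            have hj' := Finset.mem_range.mp hj
            have hvκ := hvb κ
            obtain ⟨h1, h2, h3⟩ := hP (-(j : ℤ)) (by omega) (by omega)
            exact Finset.mem_filter.mpr ⟨h1, h2, h3, by rw [hκc]; omega, by rw [hκc]; omega⟩
          · intro q hq
            have := (Finset.mem_filter.mp hq).2.2.2
            rw [Finset.mem_range]; omega
          · intro j _; rw [hκc]; simp
          · intro q hq
            obtain ⟨-, hagree, htrunk, -, hle⟩ := Finset.mem_filter.mp hq
            rw [show (-(((-(q κ)).toNat : ℕ) : ℤ)) = q κ by omega]; exact hrec q hagree htrunk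
  · -- empty run: both fibres empty
    have hE1 : box.filter (fun q => (∀ ν ∈ D, q ν = v ν) ∧ (∀ ν, ν ∉ D → ν ≠ κ → q ν = 0) ∧ 0 ≤ q κ ∧ q κ < v κ) = ∅ :=
      Finset.filter_eq_empty_iff.mpr fun q _ h => by have := h.2.2; omega
    have hE2 : box.filter (fun q => (∀ ν ∈ D, q ν = v ν) ∧ (∀ ν, ν ∉ D → ν ≠ κ → q ν = 0) ∧ v κ < q κ ∧ q κ ≤ 0) = ∅ :=
      Finset.filter_eq_empty_iff.mpr fun q _ h => by have := h.2.2; omega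
    rw [hE1, hE2, hzero]
    simp
  · -- forward run: letters `(κ,true)`, positions `q κ = j`
    have hE : box.filter (fun q => (∀ ν ∈ D, q ν = v ν) ∧ (∀ ν, ν ∉ D → ν ≠ κ → q ν = 0) ∧ v κ < q κ ∧ q κ ≤ 0) = ∅ :=
      Finset.filter_eq_empty_iff.mpr fun q _ h => by have := h.2.2; omega
    rw [hE, Finset.sum_empty, add_zero]
    calc ∑ j ∈ Finset.range (v κ).natAbs, f ((∑ ν ∈ D, v ν • e ν) + disp ((seg κ (v κ)).take j)) ((seg κ (v κ)).getD j dflt)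
        = ∑ j ∈ Finset.range (v κ).natAbs, f ((∑ ν ∈ D, v ν • e ν) + ((j : ℤ)) • e κ) (κ, true) :=
          Finset.sum_congr rfl fun j hj => by
            rw [hpos j hj, Int.sign_eq_one_of_pos hpos', getD_seg_of_nonneg κ hpos'.le j (Finset.mem_range.mp hj) dflt, one_mul]
      _ = _ := by
          refine Finset.sum_nbij' (fun j : ℕ => (∑ ν ∈ D, v ν • e ν) + ((j : ℤ)) • e κ) (fun q => (q κ).toNat) ?_ ?_ ?_ ?_ (fun _ _ => rfl)
          · intro j hj
            have hj' := Finset.mem_range.mp hj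
            have hvκ := hvb κ
            obtain ⟨h1, h2, h3⟩ := hP (j : ℤ) (by omega) (by omega)
            exact Finset.mem_filter.mpr ⟨h1, h2, h3, by rw [hκc]; omega, by rw [hκc]; omega⟩
          · intro q hq
            have := (Finset.mem_filter.mp hq).2.2.2
            rw [Finset.mem_range]; omega
          · intro j _; rw [hκc]; simp
          · intro q hq
            obtain ⟨-, hagree, htrunk, hle, -⟩ := Finset.mem_filter.mp hq
            rw [show (((q κ).toNat : ℕ) : ℤ) = q κ by omega]; exact hrec q hagree htrunk

/-- ★★ **ONE RUN SUMMED OVER THE BOX WITH A PER-COMB WEIGHT, EXACT**: `Σ_(v∈box) c v·Σ_(j<|v κ|) f(rung_j, letter_j) = Σ_(q∈box) (W⁺_(D,κ)(q)·f(q,(κ,+)) + W⁻_(D,κ)(q)·f(q,(κ,−)))`,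
`W⁺_(D,κ)(q) = Σ_(v∈box, P⁺(v,q)) c v`, `W⁻` mirror — the `=` refinement of ✓ `Prop7CombLadderCount.sum_box_run_le` (pure `Finset.sum_comm`; `c`, `f` of any sign).
[cite: Balaban1985Averaging, (8)–(9) pp.18–19, p.24] -/
theorem sum_box_mul_sum_run_eq (R : ℕ) (D : Finset (Fin d)) (κ : Fin d) (hκ : κ ∉ D) (dflt : Letter d) (c : Site d → ℝ) (f : Site d → Letter d → ℝ) :
    ∑ v ∈ Fintype.piFinset (fun _ : Fin d => Finset.Icc (-(R : ℤ)) (R : ℤ)),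
        c v * ∑ j ∈ Finset.range (seg κ (v κ)).length, f ((∑ ν ∈ D, v ν • e ν) + disp ((seg κ (v κ)).take j)) ((seg κ (v κ)).getD j dflt)
      = ∑ q ∈ Fintype.piFinset (fun _ : Fin d => Finset.Icc (-(R : ℤ)) (R : ℤ)),
          ((∑ v ∈ (Fintype.piFinset (fun _ : Fin d => Finset.Icc (-(R : ℤ)) (R : ℤ))).filter
                (fun v => (∀ ν ∈ D, q ν = v ν) ∧ (∀ ν, ν ∉ D → ν ≠ κ → q ν = 0) ∧ 0 ≤ q κ ∧ q κ < v κ), c v) * f q (κ, true)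
            + (∑ v ∈ (Fintype.piFinset (fun _ : Fin d => Finset.Icc (-(R : ℤ)) (R : ℤ))).filter
                (fun v => (∀ ν ∈ D, q ν = v ν) ∧ (∀ ν, ν ∉ D → ν ≠ κ → q ν = 0) ∧ v κ < q κ ∧ q κ ≤ 0), c v) * f q (κ, false)) := by
  classical
  set box := Fintype.piFinset (fun _ : Fin d => Finset.Icc (-(R : ℤ)) (R : ℤ)) with hbox
  have h1 : ∀ v ∈ box,
      c v * ∑ j ∈ Finset.range (seg κ (v κ)).length, f ((∑ ν ∈ D, v ν • e ν) + disp ((seg κ (v κ)).take j)) ((seg κ (v κ)).getD j dflt)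
        = ∑ q ∈ box, ((if ((∀ ν ∈ D, q ν = v ν) ∧ (∀ ν, ν ∉ D → ν ≠ κ → q ν = 0) ∧ 0 ≤ q κ ∧ q κ < v κ) then c v * f q (κ, true) else 0)
            + (if ((∀ ν ∈ D, q ν = v ν) ∧ (∀ ν, ν ∉ D → ν ≠ κ → q ν = 0) ∧ v κ < q κ ∧ q κ ≤ 0) then c v * f q (κ, false) else 0)) := by
    intro v hv
    rw [sum_run_eq R D κ hκ dflt f v hv, mul_add, Finset.mul_sum, Finset.mul_sum, Finset.sum_filter, Finset.sum_filter, ← Finset.sum_add_distrib]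
  rw [Finset.sum_congr rfl h1, Finset.sum_comm]
  refine Finset.sum_congr rfl fun q _ => ?_
  simp only [Finset.sum_add_distrib, Finset.sum_mul, Finset.sum_filter, ite_mul, zero_mul]

/-! ## §2 All runs, exact -/

/-- the determined set after the runs `l`: `ν ∈ l.foldl (fun S ν => insert ν S) D ↔ ν ∈ D ∨ ν ∈ l`. [folklore] -/
theorem mem_foldl_insert (l : List (Fin d)) : ∀ (D : Finset (Fin d)) (ν : Fin d), ν ∈ l.foldl (fun S ν => insert ν S) D ↔ ν ∈ D ∨ ν ∈ l := by
  classical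
  induction l with
  | nil => intro D ν; simp
  | cons κ l ih =>
    intro D ν
    rw [List.foldl_cons, ih (insert κ D) ν, Finset.mem_insert, List.mem_cons]
    tauto

/-- … and its cardinality: `|l.foldl insert D| = |D| + |l|` for `l` duplicate-free and disjoint from `D`. [folklore] -/
theorem card_foldl_insert (l : List (Fin d)) : ∀ (D : Finset (Fin d)), l.Nodup → (∀ κ ∈ l, κ ∉ D) →
    (l.foldl (fun S ν => insert ν S) D).card = D.card + l.length := by
  classical
  induction l with
  | nil => intro D _ _; simp
  | cons κ l ih =>
    intro D hnd hD
    have hκD : κ ∉ D := hD κ (by simp)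
    have hκl : κ ∉ l := (List.nodup_cons.mp hnd).1
    have hD' : ∀ κ' ∈ l, κ' ∉ insert κ D := by
      intro κ' hκ' h
      rcases Finset.mem_insert.mp h with h | h
      · exact hκl (h ▸ hκ')
      · exact hD κ' (by simp [hκ']) h
    rw [List.foldl_cons, ih (insert κ D) (List.nodup_cons.mp hnd).2 hD', Finset.card_insert_of_notMem hκD, List.length_cons]
    ring

/-- ★★★ **ALL RUNS, EXACT — THE COUNT AS AN IDENTITY.**  For a duplicate-free list `t` of directions disjoint from the determined set `D`, a per-comb weight `c` and a
weight `f` of (position, letter) (any signs), with `D_i := (t.take i).foldl insert D` and `κ_i := t[i]`: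
`Σ_(v ∈ box) c v · Σ_(k < |B(v)|) f (base_D v + disp (B(v)↾k)) (B(v)[k]) = Σ_(i < |t|) Σ_(q ∈ box) (W⁺_(D_i,κ_i)(q)·f(q,(κ_i,+)) + W⁻_(D_i,κ_i)(q)·f(q,(κ_i,−)))`,
`W^±_(D,κ)(q) = Σ_(v ∈ box, P^±_(D,κ)(v,q)) c v` — the `i`-th run's rung `(q,(κ_i,±))` is met EXACTLY by the combs agreeing with `q` on `D_i` and passing beyond `q κ_i`, and only
for `q` on that run's trunk. [cite: Balaban1985Averaging, (8)–(9) pp.18–19, p.24; Balaban1985UV3, (27) p.263] -/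
theorem sum_box_mul_sum_rungs_eq (R : ℕ) (dflt : Letter d) (κ₀ : Fin d) (c : Site d → ℝ) (f : Site d → Letter d → ℝ) :
    ∀ (t : List (Fin d)) (D : Finset (Fin d)), t.Nodup → (∀ κ ∈ t, κ ∉ D) →
      ∑ v ∈ Fintype.piFinset (fun _ : Fin d => Finset.Icc (-(R : ℤ)) (R : ℤ)),
          c v * ∑ k ∈ Finset.range (t.flatMap (fun κ => seg κ (v κ))).length,
            f ((∑ ν ∈ D, v ν • e ν) + disp ((t.flatMap (fun κ => seg κ (v κ))).take k)) ((t.flatMap (fun κ => seg κ (v κ))).getD k dflt)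
        = ∑ i ∈ Finset.range t.length, ∑ q ∈ Fintype.piFinset (fun _ : Fin d => Finset.Icc (-(R : ℤ)) (R : ℤ)),
            ((∑ v ∈ (Fintype.piFinset (fun _ : Fin d => Finset.Icc (-(R : ℤ)) (R : ℤ))).filter
                  (fun v => (∀ ν ∈ (t.take i).foldl (fun S ν => insert ν S) D, q ν = v ν)
                    ∧ (∀ ν, ν ∉ (t.take i).foldl (fun S ν => insert ν S) D → ν ≠ t.getD i κ₀ → q ν = 0)
                    ∧ 0 ≤ q (t.getD i κ₀) ∧ q (t.getD i κ₀) < v (t.getD i κ₀)), c v) * f q (t.getD i κ₀, true)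
              + (∑ v ∈ (Fintype.piFinset (fun _ : Fin d => Finset.Icc (-(R : ℤ)) (R : ℤ))).filter
                  (fun v => (∀ ν ∈ (t.take i).foldl (fun S ν => insert ν S) D, q ν = v ν)
                    ∧ (∀ ν, ν ∉ (t.take i).foldl (fun S ν => insert ν S) D → ν ≠ t.getD i κ₀ → q ν = 0)
                    ∧ v (t.getD i κ₀) < q (t.getD i κ₀) ∧ q (t.getD i κ₀) ≤ 0), c v) * f q (t.getD i κ₀, false))
  | [], D, _, _ => by simp
  | κ :: t, D, hnd, hD => by
    classical
    have hκD : κ ∉ D := hD κ (by simp)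
    have hκt : κ ∉ t := (List.nodup_cons.mp hnd).1
    have hnd' : t.Nodup := (List.nodup_cons.mp hnd).2
    have hD' : ∀ κ' ∈ t, κ' ∉ insert κ D := by
      intro κ' hκ' h
      rcases Finset.mem_insert.mp h with h | h
      · exact hκt (h ▸ hκ')
      · exact hD κ' (by simp [hκ']) h
    have ih := sum_box_mul_sum_rungs_eq R dflt κ₀ c f t (insert κ D) hnd' hD'
    -- split each comb's rung sum at the end of the first run
    have hsplit : ∀ v : Site d,
        ∑ k ∈ Finset.range ((κ :: t).flatMap (fun κ => seg κ (v κ))).length,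
            f ((∑ ν ∈ D, v ν • e ν) + disp (((κ :: t).flatMap (fun κ => seg κ (v κ))).take k)) (((κ :: t).flatMap (fun κ => seg κ (v κ))).getD k dflt)
          = ∑ j ∈ Finset.range (seg κ (v κ)).length, f ((∑ ν ∈ D, v ν • e ν) + disp ((seg κ (v κ)).take j)) ((seg κ (v κ)).getD j dflt)
            + ∑ k ∈ Finset.range (t.flatMap (fun κ => seg κ (v κ))).length,
                f ((∑ ν ∈ insert κ D, v ν • e ν) + disp ((t.flatMap (fun κ => seg κ (v κ))).take k)) ((t.flatMap (fun κ => seg κ (v κ))).getD k dflt) := by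
      intro v
      rw [List.flatMap_cons, sum_range_rungs_append f dflt _ (seg κ (v κ)) _, disp_seg, Finset.sum_insert hκD, add_comm (v κ • e κ)]
    rw [Finset.sum_congr rfl fun v _ => by rw [hsplit v, mul_add], Finset.sum_add_distrib, sum_box_mul_sum_run_eq R D κ hκD dflt c f, ih,
      List.length_cons, Finset.sum_range_succ', add_comm]
    rfl

/-! ## §3 The comb corollary and the consumer form (✓ `Prop7CombLoopSquareCount` with exact multiplicities) -/

/-- ★★ **THE COMB COROLLARY, EXACT** (nonneg base of ✓ `comm_hol_contour27_le_of_nonneg`): for the split `(finRange d).reverse = s ++ μ :: t`, with `D := insert μ s.toFinset`,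
`D_i := (t.take i).foldl insert D`, `κ_i := t.getD i μ`:
`Σ_(v∈box) c v·Σ_(k<|B|) f (disp (A ++ seg μ (v μ)) + disp (B↾k)) (B[k]) = Σ_(i<|t|) Σ_(q∈box) (W⁺_(D_i,κ_i)(q)·f(q,(κ_i,+)) + W⁻_(D_i,κ_i)(q)·f(q,(κ_i,−)))`.
[cite: Balaban1985UV3, (27) p.263; Balaban1985Averaging, (8)–(9) pp.18–19, p.24] -/
theorem sum_box_mul_sum_combRungs_eq (R : ℕ) (μ : Fin d) {s t : List (Fin d)} (h : (List.finRange d).reverse = s ++ μ :: t)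
    (c : Site d → ℝ) (f : Site d → Letter d → ℝ) :
    ∑ v ∈ Fintype.piFinset (fun _ : Fin d => Finset.Icc (-(R : ℤ)) (R : ℤ)),
        c v * ∑ k ∈ Finset.range (t.flatMap (fun κ => seg κ (v κ))).length,
          f (disp (s.flatMap (fun κ => seg κ (v κ)) ++ seg μ (v μ)) + disp ((t.flatMap (fun κ => seg κ (v κ))).take k))
            ((t.flatMap (fun κ => seg κ (v κ))).getD k (μ, true))
      = ∑ i ∈ Finset.range t.length, ∑ q ∈ Fintype.piFinset (fun _ : Fin d => Finset.Icc (-(R : ℤ)) (R : ℤ)),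
            ((∑ v ∈ (Fintype.piFinset (fun _ : Fin d => Finset.Icc (-(R : ℤ)) (R : ℤ))).filter
                  (fun v => (∀ ν ∈ (t.take i).foldl (fun S ν => insert ν S) (insert μ s.toFinset), q ν = v ν)
                    ∧ (∀ ν, ν ∉ (t.take i).foldl (fun S ν => insert ν S) (insert μ s.toFinset) → ν ≠ t.getD i μ → q ν = 0)
                    ∧ 0 ≤ q (t.getD i μ) ∧ q (t.getD i μ) < v (t.getD i μ)), c v) * f q (t.getD i μ, true)
              + (∑ v ∈ (Fintype.piFinset (fun _ : Fin d => Finset.Icc (-(R : ℤ)) (R : ℤ))).filter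
                  (fun v => (∀ ν ∈ (t.take i).foldl (fun S ν => insert ν S) (insert μ s.toFinset), q ν = v ν)
                    ∧ (∀ ν, ν ∉ (t.take i).foldl (fun S ν => insert ν S) (insert μ s.toFinset) → ν ≠ t.getD i μ → q ν = 0)
                    ∧ v (t.getD i μ) < q (t.getD i μ) ∧ q (t.getD i μ) ≤ 0), c v) * f q (t.getD i μ, false)) := by
  classical
  obtain ⟨-, ht, -, hμt, hts, -⟩ := split_nodup μ h
  have hD : ∀ κ ∈ t, κ ∉ insert μ s.toFinset := by
    intro κ hκ hmem
    rcases Finset.mem_insert.mp hmem with h1 | h1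
    · exact hμt (h1 ▸ hκ)
    · exact hts κ hκ (List.mem_toFinset.mp h1)
  simp_rw [disp_base_eq_sum μ h]
  exact sum_box_mul_sum_rungs_eq R (μ, true) μ c f t (insert μ s.toFinset) ht hD

section Consumer

variable {𝔸 : Type*} [NormedRing 𝔸] [NormOneClass 𝔸] (V : Site d → Fin d → 𝔸ˣ)
  (hV : ∀ (x : Site d) (κ : Fin d), ‖(V x κ : 𝔸)‖ ≤ 1 ∧ ‖(((V x κ)⁻¹ : 𝔸ˣ) : 𝔸)‖ ≤ 1)

include hV

/-- ★★★ **THE COMB-LOOP COMMUTATOR SQUARED, SUMMED OVER THE BOX — EXACT MULTIPLICITIES** (drop-in for ✓ `Prop7CombLoopSquareCount.sum_box_comm_loop_sq_le`): with the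
canonical letter `f(q,l) = N_(R(V(Γ_(0,q))⁻¹)m)(V_q(l μ l̄ μ̄))²` and the Cauchy–Schwarz per-comb weight `c(v) := |B(v)| = Σ_(κ∈t)|v κ|` INSIDE the weights,
`Σ_(v∈[−R,R]^d) N_m(V(Γ_(0,v) ∪ μ ∪ −Γ_(0,v+e_μ)))² ≤ Σ_(i<|t|) Σ_(q∈box) (W⁺_(D_i,t_i)(q)·f(q,(t_i,+)) + W⁻_(D_i,t_i)(q)·f(q,(t_i,−)))` — the only inequalities are the
ladder bound ✓ `comm_loop_le_canonical_rungs` and Cauchy–Schwarz; the count is an identity. [cite: Balaban1985UV3, (27) p.263; Balaban1985Averaging, (9) pp.18–19, (19)–(20) p.21, p.24] -/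
theorem sum_box_comm_loop_sq_le_exact (R₀ : ℕ) (μ : Fin d) {s t : List (Fin d)} (h : (List.finRange d).reverse = s ++ μ :: t) (hs : μ ∉ s) (ht : μ ∉ t) (m : 𝔸) :
    ∑ v ∈ Fintype.piFinset (fun _ : Fin d => Finset.Icc (-(R₀ : ℤ)) (R₀ : ℤ)),
        ‖((hol V 0 (contour27 0 v μ) : 𝔸ˣ) : 𝔸) * m - m * ((hol V 0 (contour27 0 v μ) : 𝔸ˣ) : 𝔸)‖ ^ 2
      ≤ ∑ i ∈ Finset.range t.length, ∑ q ∈ Fintype.piFinset (fun _ : Fin d => Finset.Icc (-(R₀ : ℤ)) (R₀ : ℤ)),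
          ((∑ v ∈ (Fintype.piFinset (fun _ : Fin d => Finset.Icc (-(R₀ : ℤ)) (R₀ : ℤ))).filter
                (fun v => (∀ ν ∈ (t.take i).foldl (fun S ν => insert ν S) (insert μ s.toFinset), q ν = v ν)
                  ∧ (∀ ν, ν ∉ (t.take i).foldl (fun S ν => insert ν S) (insert μ s.toFinset) → ν ≠ t.getD i μ → q ν = 0)
                  ∧ 0 ≤ q (t.getD i μ) ∧ q (t.getD i μ) < v (t.getD i μ)), (((t.flatMap (fun κ => seg κ (v κ))).length : ℕ) : ℝ))
              * ‖((hol V q [(t.getD i μ, true), (μ, true), B7Prop1Explicit.Letter.rev (t.getD i μ, true), (μ, false)] : 𝔸ˣ) : 𝔸) * R (hol V 0 (treeWord q))⁻¹ m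
                  - R (hol V 0 (treeWord q))⁻¹ m * ((hol V q [(t.getD i μ, true), (μ, true), B7Prop1Explicit.Letter.rev (t.getD i μ, true), (μ, false)] : 𝔸ˣ) : 𝔸)‖ ^ 2
            + (∑ v ∈ (Fintype.piFinset (fun _ : Fin d => Finset.Icc (-(R₀ : ℤ)) (R₀ : ℤ))).filter
                (fun v => (∀ ν ∈ (t.take i).foldl (fun S ν => insert ν S) (insert μ s.toFinset), q ν = v ν)
                  ∧ (∀ ν, ν ∉ (t.take i).foldl (fun S ν => insert ν S) (insert μ s.toFinset) → ν ≠ t.getD i μ → q ν = 0)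
                  ∧ v (t.getD i μ) < q (t.getD i μ) ∧ q (t.getD i μ) ≤ 0), (((t.flatMap (fun κ => seg κ (v κ))).length : ℕ) : ℝ))
              * ‖((hol V q [(t.getD i μ, false), (μ, true), B7Prop1Explicit.Letter.rev (t.getD i μ, false), (μ, false)] : 𝔸ˣ) : 𝔸) * R (hol V 0 (treeWord q))⁻¹ m
                  - R (hol V 0 (treeWord q))⁻¹ m * ((hol V q [(t.getD i μ, false), (μ, true), B7Prop1Explicit.Letter.rev (t.getD i μ, false), (μ, false)] : 𝔸ˣ) : 𝔸)‖ ^ 2) := by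
  have hper : ∀ v ∈ Fintype.piFinset (fun _ : Fin d => Finset.Icc (-(R₀ : ℤ)) (R₀ : ℤ)),
      ‖((hol V 0 (contour27 0 v μ) : 𝔸ˣ) : 𝔸) * m - m * ((hol V 0 (contour27 0 v μ) : 𝔸ˣ) : 𝔸)‖ ^ 2
        ≤ (((t.flatMap (fun κ => seg κ (v κ))).length : ℕ) : ℝ) * ∑ k ∈ Finset.range (t.flatMap (fun κ => seg κ (v κ))).length,
            (fun q l => ‖((hol V q [l, (μ, true), l.rev, (μ, false)] : 𝔸ˣ) : 𝔸) * R (hol V 0 (treeWord q))⁻¹ m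
                - R (hol V 0 (treeWord q))⁻¹ m * ((hol V q [l, (μ, true), l.rev, (μ, false)] : 𝔸ˣ) : 𝔸)‖ ^ 2)
              (disp (s.flatMap (fun κ => seg κ (v κ)) ++ seg μ (v μ)) + disp ((t.flatMap (fun κ => seg κ (v κ))).take k))
              ((t.flatMap (fun κ => seg κ (v κ))).getD k (μ, true)) :=
    fun v _ => comm_loop_sq_le V hV μ h hs ht v m
  refine (Finset.sum_le_sum hper).trans (le_of_eq ?_)
  exact sum_box_mul_sum_combRungs_eq R₀ μ h (fun v => (((t.flatMap (fun κ => seg κ (v κ))).length : ℕ) : ℝ))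
    (fun q l => ‖((hol V q [l, (μ, true), l.rev, (μ, false)] : 𝔸ˣ) : 𝔸) * R (hol V 0 (treeWord q))⁻¹ m
        - R (hol V 0 (treeWord q))⁻¹ m * ((hol V q [l, (μ, true), l.rev, (μ, false)] : 𝔸ˣ) : 𝔸)‖ ^ 2)

end Consumer

end Summit.QuantumFields.YangMills.Theorems.Prop7CombLadderCountExact
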